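import Summits.QuantumFields.GaugeBoot.Rows.GLYZc2D4HTab
import HarnessLib

/-!
# Gauge-boot: kernel check of the raw `H` class table of the glyz-c2-4D problems, rows 274–303 (part 16/20)

Cell `pub-gaugeboot` (HOME `run/shared/lean/pub/pub-gaugeboot/`), seat lean1 (torus layer for rows C76–C87 = the certified
glyz-c2-4D windows: label set, raw blocks, class/witness tables, the reduction identity, per-β bindings).

HONEST FRAMING (page 1 of every file of this cell): certified bounds on lattice expectations at STATED coupling,
gauge group, dimension and torus size; NOT a mass gap, NOT a continuum limit, NOT a string tension, NOT large `N`.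
The venture is explicitly NOT Yang–Mills-summit-bearing (barriers `FixedCouplingUltralocality`,
`PerturbativeInvisibility`).

`hcanon_rows_<lo>_<hi> : ∀ i, lo ≤ i < hi → ∀ j ≥ i, GLYZc2D4.HCanonOK i j`, each range one closed computation (`decide +kernel`);
assembled in `GLYZc2D4Canon`.
-/

noncomputable section

open Literature.MathematicalPhysics.QuantumFieldTheory

namespace Summit.QuantumFields.GaugeBoot

namespace GLYZc2D4

set_option maxHeartbeats 0 in
/-- Rows `274 ≤ i < 280` of the `H` class table of the glyz-c2-4D problems canonicalise (1335 entries; kernel). -/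
theorem hcanon_rows_274_280 : ∀ i : Fin 499, 274 ≤ i.val → i.val < 280 → ∀ j : Fin 499, i.val ≤ j.val → GLYZc2D4.HCanonOK i j := by
  decide +kernel

set_option maxHeartbeats 0 in
/-- Rows `280 ≤ i < 286` of the `H` class table of the glyz-c2-4D problems canonicalise (1299 entries; kernel). -/
theorem hcanon_rows_280_286 : ∀ i : Fin 499, 280 ≤ i.val → i.val < 286 → ∀ j : Fin 499, i.val ≤ j.val → GLYZc2D4.HCanonOK i j := by
  decide +kernel

set_option maxHeartbeats 0 in
/-- Rows `286 ≤ i < 292` of the `H` class table of the glyz-c2-4D problems canonicalise (1263 entries; kernel). -/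
theorem hcanon_rows_286_292 : ∀ i : Fin 499, 286 ≤ i.val → i.val < 292 → ∀ j : Fin 499, i.val ≤ j.val → GLYZc2D4.HCanonOK i j := by
  decide +kernel

set_option maxHeartbeats 0 in
/-- Rows `292 ≤ i < 298` of the `H` class table of the glyz-c2-4D problems canonicalise (1227 entries; kernel). -/
theorem hcanon_rows_292_298 : ∀ i : Fin 499, 292 ≤ i.val → i.val < 298 → ∀ j : Fin 499, i.val ≤ j.val → GLYZc2D4.HCanonOK i j := by
  decide +kernel

set_option maxHeartbeats 0 in
/-- Rows `298 ≤ i < 304` of the `H` class table of the glyz-c2-4D problems canonicalise (1191 entries; kernel). -/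
theorem hcanon_rows_298_304 : ∀ i : Fin 499, 298 ≤ i.val → i.val < 304 → ∀ j : Fin 499, i.val ≤ j.val → GLYZc2D4.HCanonOK i j := by
  decide +kernel

end GLYZc2D4

end Summit.QuantumFields.GaugeBoot

end
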